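import Summits.QuantumFields.YangMills.Theorems.UnitScaleTiltProp7ChartRealityKnitS
import HarnessLib

/-!
# Route `UnitScaleTilt`, crux K1 child «MinimiserStabilityRegPr» (stmt-QuantumFields-19200), skeleton v10, stub `stub_existenceMinimalOrbit` (EX),
# route (α) — **(Q-a) AS A THEOREM: THE AVERAGING DERIVATIVE `QTwS U₀` OF THE RE-BASED SYMMETRIC CHART MAPS `𝔰𝔲(2)`-VALUED FINE FIELDS TO
# `𝔰𝔲(2)`-VALUED BLOCK FIELDS** at every printed-regular background `U₀ ∈ 𝔘_k(ε₀)` inside the two windows of record `10⁹L²e ≤ 1`, `10¹²L³ε₀ ≤ 1`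

Cell `ym3-torus`, width seat `ym-ust-20520-w4` (gen 4).  THEOREMS ONLY (0 `def`, 0 `sorry`).  The 25-line corollary ym-inputs-p03 g2's LOCATE memo
`pub/ym-inputs/REALITY-ROWS-LOCATE-p03g2.md` §3 (Q-a) names («IN THE TREE by composition — … a corollary nobody has stated standalone (call it `QTwS_mem_su2_of_regPr`)»),
composed exactly as located: ✓`Prop7ChartRealityTwS.fderiv_apply_mem_of_mapsTo_of_ball` (the derivative at `0` of a map sending `S ∩ ball` into a closed `S′` sends `S` into `S′`)
at `f := logChartTwS U₀`, `f′(0) = QTwS U₀` (W5 ✓`Prop7CmapTwSymInputs.analyticOnNhd_logChartTwS` on the ball `e·η`), `f 0 = 0` (✓`logChartTwS_zero`), with `hmaps` =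
✓`logChartTwS_skewHermitian_of_ball` ∘ ✓`dbarTwS_mem_specialUnitaryUnits_of_skewHermitian` and the closedness ✓`Prop7ChartRealityKnitS.isClosed_skewHermitian_traceless`.
Plumbing for the reality split (R) of the EX knit (knit ruler ★w2-19200 g3; rows `h46tw`.(R-H), `hH₁R`, `hA₁R` via the desk's (G1)–(G3) + (Q-a)∕(Q-b)); nothing here closes the stub;
`--supports stmt-QuantumFields-19200 --as helper`, count-neutral.  YM₃ on T³ is a ladder rung (R3), not the Clay problem; nothing here claims the stub, the crux, d = 4 or the mass gap.

THE PRINT.  [Balaban1985BackgroundPropagators] (3.13)–(3.14) p. 393: the averaging operation `Q(U₀)` is the derivative at `A = 0` of `A ↦ (1∕i) log Ū(e^{iA}U₀)`, «a linear operator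
… with values in the Lie algebra 𝔤»; [Balaban1985Variational] (51) p. 286: «for A′ with values in 𝔤 the configuration … has values in 𝔤 also».  Here `𝔤 = 𝔰𝔲(2)` = the skew-Hermitian
traceless `2 × 2` matrices, and `Q(U₀)` is the cell's `QTwS U₀ = fderiv ℂ (logChartTwS U₀) 0` (symmetric covariant frames, ★★OWNER RULING g26-№12).

WHAT IS PROVED (sorry-free, no definition).  ★★ **`QTwS_skewHermitian_traceless_of_regPr`**: at `U₀ ∈ 𝔘_k(ε₀)` (`RegPr F n K ε₀ U₀`) with `0 < e`, `10⁹L²e ≤ 1`,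
`10¹²L³ε₀ ≤ 1`: for every fine field `A` with `A(b)* = −A(b)`, `tr A(b) = 0` and every block bond `c`, `(QTwS U₀ A c)* = −QTwS U₀ A c` and `tr (QTwS U₀ A c) = 0`; and the
Hermitian-traceless reading ★★ **`QTwS_I_smul_isHermitian_trace_zero_of_regPr`** (`A = iX`, `X` Hermitian traceless ⇒ `QTwS U₀ (iX) c = i·Y(c)` with `Y(c)` Hermitian traceless, stated as
`(−i)·QTwS U₀ (iX) c` Hermitian and traceless).  (Q-b) — `QTwS U₀` on SCALAR fields `c(b)·1` (centre-equivariance of the tower) — is NOT here.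

References: T. Bałaban, CMP 99 (1985) 389–434 [Balaban1985BackgroundPropagators] ((3.13)–(3.14) p.393); CMP 102 (1985) 277–309 [Balaban1985Variational] ((51) p.286).
-/

set_option autoImplicit false

noncomputable section

open Metric Set
open scoped Matrix.Norms.L2Operator

namespace Summit.QuantumFields.YangMills.Theorems.Prop7QTwSReality

open Literature.MathematicalPhysics.QuantumFieldTheory.Balaban1983to89
open Literature.MathematicalPhysics.QuantumFieldTheory.Balaban1983to89.T3ContinuumYM3Torus
open T3PrintedRegularMinimiser (RegPr)
open T3SectALandauChart (eta eta_pos)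
open Summit.QuantumFields.YangMills.Theorems.Prop7SymAvgTwSym (logChartTwS QTwS logChartTwS_zero QTwS_def)
open Summit.QuantumFields.YangMills.Theorems.Prop7ChartRealityTwS (fderiv_apply_mem_of_mapsTo_of_ball logChartTwS_skewHermitian_of_ball
  dbarTwS_mem_specialUnitaryUnits_of_skewHermitian)
open Summit.QuantumFields.YangMills.Theorems.Prop7CmapTwSymInputs (analyticOnNhd_logChartTwS)
open Summit.QuantumFields.YangMills.Theorems.Prop7ChartRealityKnitS (isClosed_skewHermitian_traceless)

variable (F : T3Family) {n K : ℕ} (h : n ≤ K)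

/-- ★★ **(Q-a): `QTwS U₀` MAPS `𝔰𝔲(2)`-VALUED FINE FIELDS TO `𝔰𝔲(2)`-VALUED BLOCK FIELDS** at `U₀ ∈ 𝔘_k(ε₀)` inside the windows `10⁹L²e ≤ 1`, `10¹²L³ε₀ ≤ 1` — the derivative at `0`
(`QTwS U₀ = fderiv ℂ (logChartTwS U₀) 0`, W5's analyticity on the ball `e·η`) of a chart that vanishes at `0` and sends the `𝔰𝔲(2)`-valued fields of the ball into the CLOSED real
subspace of `𝔰𝔲(2)`-valued block fields (`logChartTwS_skewHermitian_of_ball` on `SU(2)`-valued averages `dbarTwS_mem_specialUnitaryUnits_of_skewHermitian`).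
[cite: Balaban1985BackgroundPropagators, (3.13)–(3.14) p.393; Balaban1985Variational, (51) p.286] -/
theorem QTwS_skewHermitian_traceless_of_regPr [Fact (0 < (F.L : ℝ))] [Fact (0 < ((F.L : ℝ)⁻¹) ^ (K - n))]
    {ε₀ e : ℝ} (hε₀ : 0 < ε₀) (he : 0 < e) (hWe : 10 ^ 9 * (F.L : ℝ) ^ 2 * e ≤ 1) (hWε : 10 ^ 12 * (F.L : ℝ) ^ 3 * ε₀ ≤ 1)
    (U₀ : GaugeField (F.P K) 0 (Matrix.specialUnitaryGroup (Fin 2) ℂ)) (hreg : RegPr F n K ε₀ U₀)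
    (A : PBond (F.P K) 0 → Matrix (Fin 2) (Fin 2) ℂ) (hA : ∀ b, star (A b) = -A b ∧ (A b).trace = 0) (c : PBond (F.P n) 0) :
    star (QTwS F n K h U₀ A c) = -QTwS F n K h U₀ A c ∧ (QTwS F n K h U₀ A c).trace = 0 := by
  -- the real subspaces of skew-Hermitian traceless fields (fine) and block fields (coarse)
  let S : Submodule ℝ (PBond (F.P K) 0 → Matrix (Fin 2) (Fin 2) ℂ) :=
    { carrier := {A | ∀ b', star (A b') = -A b' ∧ (A b').trace = 0}
      add_mem' := fun {A B} hA hB b' => by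
        refine ⟨?_, ?_⟩
        · rw [Pi.add_apply, star_add, (hA b').1, (hB b').1, neg_add]
        · rw [Pi.add_apply, Matrix.trace_add, (hA b').2, (hB b').2, add_zero]
      zero_mem' := fun b' => by simp
      smul_mem' := fun r A hA b' => by
        refine ⟨?_, ?_⟩
        · rw [Pi.smul_apply, star_smul, star_trivial, (hA b').1, smul_neg]
        · rw [Pi.smul_apply, Matrix.trace_smul, (hA b').2, smul_zero] }
  let S' : Submodule ℝ (PBond (F.P n) 0 → Matrix (Fin 2) (Fin 2) ℂ) :=
    { carrier := {Y | ∀ c, star (Y c) = -Y c ∧ (Y c).trace = 0}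
      add_mem' := fun {A B} hA hB c => by
        refine ⟨?_, ?_⟩
        · rw [Pi.add_apply, star_add, (hA c).1, (hB c).1, neg_add]
        · rw [Pi.add_apply, Matrix.trace_add, (hA c).2, (hB c).2, add_zero]
      zero_mem' := fun c => by simp
      smul_mem' := fun r A hA c => by
        refine ⟨?_, ?_⟩
        · rw [Pi.smul_apply, star_smul, star_trivial, (hA c).1, smul_neg]
        · rw [Pi.smul_apply, Matrix.trace_smul, (hA c).2, smul_zero] }
  have hS'c : IsClosed (S' : Set (PBond (F.P n) 0 → Matrix (Fin 2) (Fin 2) ℂ)) := isClosed_skewHermitian_traceless (PBond (F.P n) 0)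
  -- the chart is differentiable at `0` with derivative `QTwS U₀` (W5) and vanishes there
  have hρ : 0 < e * eta F n K := mul_pos he (eta_pos F n K)
  have hf : HasFDerivAt (logChartTwS F n K h U₀) (QTwS F n K h U₀) 0 := by
    rw [QTwS_def]
    have h0 : (0 : PBond (F.P K) 0 → Matrix (Fin 2) (Fin 2) ℂ) ∈ ball (0 : PBond (F.P K) 0 → Matrix (Fin 2) (Fin 2) ℂ) (e * eta F n K) :=
      mem_ball_self hρ
    exact ((analyticOnNhd_logChartTwS F h hε₀ he hWe hWε U₀ hreg) 0 h0).differentiableAt.hasFDerivAt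
  have hf0 : logChartTwS F n K h U₀ 0 = 0 := logChartTwS_zero U₀
  -- reality of the chart on the ball `‖y‖ < e·η` (SU(2)-valued averages of SU(2) data)
  have hmaps : ∀ y ∈ S, ‖y‖ < e * eta F n K → logChartTwS F n K h U₀ y ∈ S' := fun y hy hyR c' =>
    logChartTwS_skewHermitian_of_ball F h hε₀ he.le hWe hWε U₀ hreg y (fun b => (norm_le_pi_norm y b).trans hyR.le)
      (fun c'' => dbarTwS_mem_specialUnitaryUnits_of_skewHermitian F h hε₀ he.le hWe hWε U₀ hreg y hy
        (fun b => (norm_le_pi_norm y b).trans hyR.le) c'') c'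
  have key : QTwS F n K h U₀ A ∈ S' := fderiv_apply_mem_of_mapsTo_of_ball hf hf0 S S' hS'c hρ hmaps (v := A) hA
  exact key c

/-- ★★ **THE HERMITIAN-TRACELESS READING**: for `X` Hermitian traceless (the knit's currency), `QTwS U₀ (iX)` is `i` times a Hermitian traceless block field — stated as
`(−i)·QTwS U₀ (iX) c` Hermitian with trace `0` (`ℂ`-linearity is NOT used: only (Q-a) at the skew-Hermitian traceless field `A := iX`).
[cite: Balaban1985BackgroundPropagators, (3.13)–(3.14) p.393; Balaban1985Variational, (51) p.286] -/
theorem QTwS_I_smul_isHermitian_trace_zero_of_regPr [Fact (0 < (F.L : ℝ))] [Fact (0 < ((F.L : ℝ)⁻¹) ^ (K - n))]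
    {ε₀ e : ℝ} (hε₀ : 0 < ε₀) (he : 0 < e) (hWe : 10 ^ 9 * (F.L : ℝ) ^ 2 * e ≤ 1) (hWε : 10 ^ 12 * (F.L : ℝ) ^ 3 * ε₀ ≤ 1)
    (U₀ : GaugeField (F.P K) 0 (Matrix.specialUnitaryGroup (Fin 2) ℂ)) (hreg : RegPr F n K ε₀ U₀)
    (X : PBond (F.P K) 0 → Matrix (Fin 2) (Fin 2) ℂ) (hX : ∀ b, (X b).IsHermitian ∧ (X b).trace = 0) (c : PBond (F.P n) 0) :
    ((-Complex.I) • QTwS F n K h U₀ (fun b => Complex.I • X b) c).IsHermitian ∧ ((-Complex.I) • QTwS F n K h U₀ (fun b => Complex.I • X b) c).trace = 0 := by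
  have hA : ∀ b, star (Complex.I • X b) = -(Complex.I • X b) ∧ (Complex.I • X b).trace = 0 := fun b => by
    refine ⟨?_, by rw [Matrix.trace_smul, (hX b).2, smul_zero]⟩
    rw [star_smul, Complex.star_def, Complex.conj_I, neg_smul, Matrix.star_eq_conjTranspose, (hX b).1.eq]
  obtain ⟨hst, htr⟩ := QTwS_skewHermitian_traceless_of_regPr F h hε₀ he hWe hWε U₀ hreg (fun b => Complex.I • X b) hA c
  refine ⟨?_, by rw [Matrix.trace_smul, htr, smul_zero]⟩
  rw [Matrix.IsHermitian, ← Matrix.star_eq_conjTranspose, star_smul, star_neg, Complex.star_def, Complex.conj_I, neg_neg, hst, smul_neg, neg_smul]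

end Summit.QuantumFields.YangMills.Theorems.Prop7QTwSReality

end
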